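import Mathlib
import HarnessLib
import Summits.HubbardSuperconductivity.HubbardSuperconductivity.Theorems.KLProgrammeKLRegimeVolumeLimitSecondOrderSunsetUp
import Summits.HubbardSuperconductivity.HubbardSuperconductivity.Theorems.KLProgrammeKLRegimeVolumeLimitSecondOrderSunsetDown

/-!
# Child `KLRegimeVolumeLimit` (stmt-HubbardSuperconductivity-19665 / its gen-3 twin) — the ORDER-`U²` RUNG of the volume-limit
# carrier, EVALUATED: sunset + reducible double tadpole + tadpole-with-tadpole-insertion (seat hubbard-kl-k3c5-p3)

Assembling `…SecondOrderWick` (`K₂ = 2(βL²ĝ₀)²(∫∂⁺W·∂⁻W + Cov(W,∂⁺∂⁻W))`, `Cov = −(βL²)⁻³ T₂ T`) with the six-point functions of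
`…SecondOrderSunsetUp/Down` (`∫∂⁺W·∂⁻W = (βL²)⁻³(Sun − ĝ₀T²)`, either spin):

  **`N₂ − N₀D₂ − 2D₁(N₁ − N₀D₁) = (2/βL²) ĝ₀(k)² (Sun(k) − ĝ₀(k) T² − T·T₂)`**   (`secondCumulant_eq`),
  **`d²/dU²|₀ klSelfEnergy L M β U μ K klE0 (nScales β + 1) (k,σ) = 2 (ĝ₀(k)/ĝ_K(k))² (βL²)⁻² (Sun(k) − ĝ₀(k) T² − T·T₂)`**
  (`hasDerivAt_deriv_klSelfEnergy_nScales_succ_zero_eval`, from `…SecondOrder.hasDerivAt_deriv_klSelfEnergy_nScales_succ_zero`),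

with `ĝ₀ = 1/(−iω + ξ)` the BARE propagator (`propCT … 0`), `Sun(k) = Σ_{k+k₃=k₂+k₄} ĝ₀(k₂)ĝ₀(k₃)ĝ₀(k₄)` (exact conservation of the `2M`
kept frequency labels and of the torus momentum), `T = Σ_q ĝ₀(q)`, `T₂ = Σ_q ĝ₀(q)²`; the frame `K` enters only through the square of
the zero-coupling dressing `ĝ₀/ĝ_K = (−iω + e_K)/(−iω + ξ)` (`…VolumeLimitHartree.propCT_zero_div_propCT`), exactly as at order `U¹`.
`(βL²)⁻² Sun` is the finite-volume sunset functional `klSunset` of `…VolumeLimitSunset` (seat k3c4-p1) at the bare symbol, so the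
VL-shaped volume limit of this coefficient (the sequel) reads the model-free sunset rung plus two one-loop limits.  Everything is
proved; no definition.
-/

noncomputable section

namespace Summit.HubbardSuperconductivity.HubbardSuperconductivity.Theorems.TwoPointAssembly

set_option linter.dupNamespace false -- summit = problem name (single-conjunct summit), D-0017

open Finset Filter Topology Literature.MathematicalPhysics.QuantumLattice Literature.Probability.LatticeModels GrassmannAlgebra
open Summit.HubbardSuperconductivity.HubbardSuperconductivity.Theorems.KLRegimeSplit
open Summit.HubbardSuperconductivity.HubbardSuperconductivity.Theorems.KLProgrammeLegKernels

variable {L M : ℕ} [NeZero L]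

/-! ## §5 The order-`U²` rung, evaluated -/

/-- **The second cumulant, evaluated** (bare seedless covariance, `β ≠ 0`, any spin):
`N₂ − N₀D₂ − 2D₁(N₁ − N₀D₁) = (2/βL²) ĝ₀(k)² (Sun(k) − ĝ₀(k) T² − T·T₂)`,
`Sun(k) = Σ_{k+k₃=k₂+k₄} ĝ₀(k₂)ĝ₀(k₃)ĝ₀(k₄)`, `T = Σ_q ĝ₀(q)`, `T₂ = Σ_q ĝ₀(q)²`. -/
theorem secondCumulant_eq {β : ℝ} (hβ : β ≠ 0) (μ : ℝ) (k : FreqMomentum L M) (σ : Fin 2) :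
    gaussExpect ℂ (hubbardCovariance L M β μ 0)
            (gen ℂ (((k, σ), 0) : HubbardFieldIdx L M) * gen ℂ (((k, σ), 1) : HubbardFieldIdx L M) *
              hubbardInteraction L M β 1 ^ 2) -
          gaussExpect ℂ (hubbardCovariance L M β μ 0)
              (gen ℂ (((k, σ), 0) : HubbardFieldIdx L M) * gen ℂ (((k, σ), 1) : HubbardFieldIdx L M)) *
            gaussExpect ℂ (hubbardCovariance L M β μ 0) (hubbardInteraction L M β 1 ^ 2) -
        2 * gaussExpect ℂ (hubbardCovariance L M β μ 0) (hubbardInteraction L M β 1) *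
          (gaussExpect ℂ (hubbardCovariance L M β μ 0)
              (gen ℂ (((k, σ), 0) : HubbardFieldIdx L M) * gen ℂ (((k, σ), 1) : HubbardFieldIdx L M) *
                hubbardInteraction L M β 1) -
            gaussExpect ℂ (hubbardCovariance L M β μ 0)
                (gen ℂ (((k, σ), 0) : HubbardFieldIdx L M) * gen ℂ (((k, σ), 1) : HubbardFieldIdx L M)) *
              gaussExpect ℂ (hubbardCovariance L M β μ 0) (hubbardInteraction L M β 1)) =
      2 / ((β * (L : ℝ) ^ 2 : ℝ) : ℂ) * propCT L M β μ 0 k ^ 2 *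
        ((∑ k₂ : FreqMomentum L M, ∑ k₃ : FreqMomentum L M, ∑ k₄ : FreqMomentum L M,
            if matsubaraInt M k.1 + matsubaraInt M k₃.1 = matsubaraInt M k₂.1 + matsubaraInt M k₄.1 ∧ k.2 + k₃.2 = k₂.2 + k₄.2 then
              propCT L M β μ 0 k₂ * propCT L M β μ 0 k₃ * propCT L M β μ 0 k₄ else 0) -
          propCT L M β μ 0 k * (∑ q : FreqMomentum L M, propCT L M β μ 0 q) ^ 2 -
          (∑ q : FreqMomentum L M, propCT L M β μ 0 q) * ∑ q : FreqMomentum L M, propCT L M β μ 0 q ^ 2) := by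
  have hβC : (β : ℂ) ≠ 0 := by exact_mod_cast hβ
  have hLC : (L : ℂ) ≠ 0 := by exact_mod_cast (NeZero.ne L)
  have hcov := cov_hubbardInteraction_dd hβ μ k σ
  rw [← hubbardCovarianceCT_zero_frame] at hcov ⊢
  have hsix : gaussExpect ℂ (hubbardCovarianceCT L M β μ 0 0)
      (grassmannDeriv ℂ (((k, σ), 0) : HubbardFieldIdx L M) (hubbardInteraction L M β 1) *
        grassmannDeriv ℂ (((k, σ), 1) : HubbardFieldIdx L M) (hubbardInteraction L M β 1)) =
      (((1 / (β * (L : ℝ) ^ 2) ^ 3 : ℝ) : ℂ)) ^ 2 * (((β * (L : ℝ) ^ 2 : ℝ) : ℂ) ^ 3 *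
        ((∑ k₂ : FreqMomentum L M, ∑ k₃ : FreqMomentum L M, ∑ k₄ : FreqMomentum L M,
            if matsubaraInt M k.1 + matsubaraInt M k₃.1 = matsubaraInt M k₂.1 + matsubaraInt M k₄.1 ∧ k.2 + k₃.2 = k₂.2 + k₄.2 then
              propCT L M β μ 0 k₂ * propCT L M β μ 0 k₃ * propCT L M β μ 0 k₄ else 0) -
          propCT L M β μ 0 k * (∑ q : FreqMomentum L M, propCT L M β μ 0 q) ^ 2)) := by
    fin_cases σ
    · exact gaussExpect_dPlus_mul_dMinus_up hβ μ 0 k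
    · exact gaussExpect_dPlus_mul_dMinus_down hβ μ 0 k
  rw [secondCumulant_eq_two_mul hβ μ 0 k σ, hsix, hcov]
  push_cast
  field_simp
  ring

/-- **The ORDER-`U²` RUNG of the VL carrier, evaluated**: for `β > 0`,
`d²/dU²|₀ klSelfEnergy L M β U μ K klE0 (nScales β + 1) (k,σ) = 2 (ĝ₀(k)/ĝ_K(k))² (βL²)⁻² (Sun(k) − ĝ₀(k) T² − T·T₂)`
— sunset, one-particle-reducible double tadpole and tadpole-with-tadpole-insertion of the BARE propagator `ĝ₀ = 1/(−iω + ξ)`, dressed by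
the square of the zero-coupling frame factor `ĝ₀/ĝ_K`; spin-independent. -/
theorem hasDerivAt_deriv_klSelfEnergy_nScales_succ_zero_eval {β : ℝ} (hβ : 0 < β) (μ : ℝ) (K : TrigPolyC4v) (k : FreqMomentum L M)
    (σ : Fin 2) :
    HasDerivAt (deriv fun U : ℝ => klSelfEnergy L M β U μ K klE0 (nScales β + 1) k σ)
      (2 * (propCT L M β μ 0 k / propCT L M β μ K k) ^ 2 *
        (((∑ k₂ : FreqMomentum L M, ∑ k₃ : FreqMomentum L M, ∑ k₄ : FreqMomentum L M,
            if matsubaraInt M k.1 + matsubaraInt M k₃.1 = matsubaraInt M k₂.1 + matsubaraInt M k₄.1 ∧ k.2 + k₃.2 = k₂.2 + k₄.2 then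
              propCT L M β μ 0 k₂ * propCT L M β μ 0 k₃ * propCT L M β μ 0 k₄ else 0) -
          propCT L M β μ 0 k * (∑ q : FreqMomentum L M, propCT L M β μ 0 q) ^ 2 -
          (∑ q : FreqMomentum L M, propCT L M β μ 0 q) * ∑ q : FreqMomentum L M, propCT L M β μ 0 q ^ 2) /
          ((β * (L : ℝ) ^ 2 : ℝ) : ℂ) ^ 2)) 0 := by
  have hβL : ((β * (L : ℝ) ^ 2 : ℝ) : ℂ) ≠ 0 := by
    have hL : (L : ℝ) ≠ 0 := by exact_mod_cast NeZero.ne L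
    exact_mod_cast mul_ne_zero hβ.ne' (pow_ne_zero 2 hL)
  have hg := propCT_ne_zero (L := L) hβ.ne' μ K k
  refine (hasDerivAt_deriv_klSelfEnergy_nScales_succ_zero hβ μ K k σ).congr_deriv ?_
  rw [secondCumulant_eq hβ.ne' μ k σ]
  field_simp

end Summit.HubbardSuperconductivity.HubbardSuperconductivity.Theorems.TwoPointAssembly

end
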